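import Summits.BirchSwinnertonDyer.BirchSwinnertonDyer.Theorems.UniversalToricDescentRoadFFMemberSaturation
import HarnessLib

/-!
# Route `UniversalToricDescent`, ♭B column (♭B′ `TwinWanFrameAtThreeMultTresT` 27401), line `membertower` v10:
# the PRINTED two-sided congruence `(Q) + (p^m) = (M) + (p^m)` [Castella's erratum, (c)] forces a UNIT congruence
# `Q = u·M + p^m·G` when `μ(M) < m` (by `p`-saturation, p628881)

Cell `bsd-wall` (run/shared/lean/pub/bsd-wall/), seat `bsd-wall-utd-p2` (lead prover g13, 2026-08-28);
`--supports stmt-BirchSwinnertonDyer-27401 --as helper`; Theses-free, pure algebra.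

`RoadFFSaturation.exists_unit_congruence_of_span_sup_eq`: over a domain `S` in which `1 − π·h` is a unit for every `h` (`π` in the
Jacobson radical; e.g. `S = 𝓞_{ℂ_p}`, `π = p`), for `M = C π^t·M′` with `M′ = X^s·V + C π·Q′` (`V` a unit) and `t < m`, the ideal
equality `(Q) + (C π^m) = (M) + (C π^m)` gives `Q = u·M + C π^m·G` with `u` a unit. Consumer: `…RoadFFCpIntMemberTower.lean` (the
Road-FF kernel with members read in `𝓞_{ℂ_p}⟦T⟧`). HONEST FRAMING: theorems only; nothing booked; BSD is proved for no curve.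
References: [Castella2018Erratum] proof of Thm. 1.1 (c) (p. 4) (the printed shape); [Washington1997] §7.1.
-/

set_option autoImplicit false

noncomputable section

open scoped Classical

open PowerSeries

namespace Summit.BirchSwinnertonDyer.Rank1Residual.X11b

/-! ### §1 The printed two-sided congruence forces a unit congruence -/

namespace RoadFFSaturation

/-- **`(Q) + (π^m) = (M) + (π^m)` ⟹ `Q = u·M + π^m·G` with `u` a unit**, over a domain `S` in which `1 − π·h` is always a unit
(`π` in the Jacobson radical), for `M = C π^t·M′`, `M′ = X^s·V + C π·Q′` with `V` a unit and `t < m`: write `Q = c′M + π^m g′`,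
`M = cQ + π^m g`; then `(1 − cc′)·M ∈ (π^m)`, so `(1 − cc′)·M′ ∈ (π^{m−t})` (cancel `π^t`), so `M′ ∣ ` the cofactor by `p`-saturation
(p628881), so `1 − cc′ ∈ (π^{m−t})` (cancel `M′ ≠ 0`), so `cc′`, hence `c`, is a unit. [folklore] -/
theorem exists_unit_congruence_of_span_sup_eq {S : Type*} [CommRing S] [IsDomain S] {π : S}
    (hπ : ∀ z : S, π * z = 0 → z = 0) (hJ : ∀ h : S, IsUnit (1 - π * h))
    {Q M M' V Q' : PowerSeries S} (t s m : ℕ) (htm : t < m) (hV : IsUnit V)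
    (hM : M = C π ^ t * M') (hM' : M' = X ^ s * V + C π * Q')
    (h : Ideal.span {Q} ⊔ Ideal.span {C π ^ m} = Ideal.span {M} ⊔ Ideal.span {C π ^ m}) :
    ∃ u G : PowerSeries S, IsUnit u ∧ Q = u * M + C π ^ m * G := by
  obtain ⟨d, rfl⟩ : ∃ d : ℕ, m = t + 1 + d := ⟨m - t - 1, by omega⟩
  -- `Q = c′M + g′·π^m`, `M = cQ + g·π^m`
  have hQ : Q ∈ Ideal.span {M} ⊔ Ideal.span {C π ^ (t + 1 + d)} :=
    h ▸ Ideal.mem_sup_left (Ideal.mem_span_singleton_self Q)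
  have hMm : M ∈ Ideal.span {Q} ⊔ Ideal.span {C π ^ (t + 1 + d)} :=
    h.symm ▸ Ideal.mem_sup_left (Ideal.mem_span_singleton_self M)
  obtain ⟨_, hu₁, _, hv₁, hQeq⟩ := Submodule.mem_sup.mp hQ
  obtain ⟨c', rfl⟩ := Ideal.mem_span_singleton'.mp hu₁
  obtain ⟨g', rfl⟩ := Ideal.mem_span_singleton'.mp hv₁
  obtain ⟨_, hu₂, _, hv₂, hMeq⟩ := Submodule.mem_sup.mp hMm
  obtain ⟨c, rfl⟩ := Ideal.mem_span_singleton'.mp hu₂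
  obtain ⟨g, rfl⟩ := Ideal.mem_span_singleton'.mp hv₂
  -- `M′ ≠ 0`: its coefficient `s` is `V₀·(1 − π·(−V₀⁻¹q))`, a unit
  have hM'0 : M' ≠ 0 := by
    intro h0
    obtain ⟨v, hv⟩ := PowerSeries.isUnit_iff_constantCoeff.mp hV
    have hs : coeff s M' = (v : S) * (1 - π * (-(↑v⁻¹ * coeff s Q'))) := by
      rw [hM', map_add, coeff_X_pow_mul', if_pos le_rfl, Nat.sub_self, coeff_C_mul, coeff_zero_eq_constantCoeff_apply,
        ← hv]
      calc (v : S) + π * coeff s Q' = v + π * coeff s Q' * ((v : S) * ↑v⁻¹) := by rw [Units.mul_inv, mul_one]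
        _ = (v : S) * (1 - π * (-(↑v⁻¹ * coeff s Q'))) := by ring
    have hunit : IsUnit (coeff s M') := by
      rw [hs]
      exact (Units.isUnit v).mul (hJ _)
    rw [h0, map_zero] at hunit
    exact not_isUnit_zero hunit
  -- cancellation of `C π^k`
  have hπCk : ∀ (k : ℕ) (A : PowerSeries S), C π ^ k * A = 0 → A = 0 := by
    intro k
    induction k with
    | zero => intro A hA; simpa using hA
    | succ k ih =>
      intro A hA
      refine ih A (eq_zero_of_C_mul_eq_zero hπ ?_)
      rw [← mul_assoc, ← pow_succ']
      exact hA
  -- `(1 − cc′)·M = C π^{t+1+d}·(c g′ + g)`, then cancel `C π^t`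
  have e1 : (1 - c * c') * M = C π ^ (t + 1 + d) * (c * g' + g) := by
    have e0 : M = c * Q + g * C π ^ (t + 1 + d) := hMeq.symm
    rw [← hQeq] at e0
    linear_combination e0
  have h1 : (1 - c * c') * M' = C π ^ (1 + d) * (c * g' + g) := by
    refine sub_eq_zero.mp (hπCk t _ ?_)
    have : C π ^ t * ((1 - c * c') * M' - C π ^ (1 + d) * (c * g' + g)) =
        (1 - c * c') * M - C π ^ (t + 1 + d) * (c * g' + g) := by
      rw [hM]; ring
    rw [this, e1, sub_self]
  -- saturation: `M′ ∣ c g′ + g`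
  have hdvd : M' ∣ C π ^ (1 + d) * (c * g' + g) := ⟨1 - c * c', by rw [← h1]; ring⟩
  obtain ⟨h', hh'⟩ := dvd_of_dvd_C_pow_mul_of_shape hπ hV s hM' (1 + d) hdvd
  -- cancel `M′`: `1 − cc′ = C π^{1+d}·h′`
  have h2 : 1 - c * c' = C π ^ (1 + d) * h' := by
    have : M' * (1 - c * c') = M' * (C π ^ (1 + d) * h') := by
      rw [mul_comm M' (1 - c * c'), h1, hh']; ring
    exact mul_left_cancel₀ hM'0 this
  -- `cc′` is a unit, hence `c`
  have hcc' : IsUnit (c * c') := by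
    have e2 : c * c' = 1 - C π * (C π ^ d * h') := by
      rw [← mul_assoc, ← pow_succ', show d + 1 = 1 + d from by omega, ← h2]; ring
    rw [e2, PowerSeries.isUnit_iff_constantCoeff, map_sub, map_one, map_mul, constantCoeff_C]
    exact hJ _
  obtain ⟨cu, hcu⟩ := isUnit_of_mul_isUnit_left hcc'
  refine ⟨↑cu⁻¹, -(↑cu⁻¹ * g), Units.isUnit _, ?_⟩
  have e3 : (cu : PowerSeries S) * Q = M - g * C π ^ (t + 1 + d) := by rw [hcu, ← hMeq]; ring
  calc Q = ↑cu⁻¹ * (↑cu * Q) := by rw [← mul_assoc, Units.inv_mul, one_mul]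
    _ = ↑cu⁻¹ * M + C π ^ (t + 1 + d) * -(↑cu⁻¹ * g) := by rw [e3]; ring

end RoadFFSaturation


end Summit.BirchSwinnertonDyer.Rank1Residual.X11b

end
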